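import Mathlib
import HarnessLib
import Summits.AtomisticToContinuum.Crystallization.Theorems.FrustratedLawDichotomyTwoShellRigidityLsFitReplay

/-!
# Two-shell rigidity, slot 3 · the `SphericalLsFit` replay engine (1b): the decoder and table sanity checks
# (decomp-a2c, lens 3, gen 37 — NODE «SphericalLsFitReplay»; mechanical split of part (1) for the 400-line rule)

The byte decoder `decodeCellF` of a fit-run cell (same format as `…RigModels.decodeCell`: `xpos zz(tlo) zz(thi) instr*`,
opcodes 0 bound, 1 prune, 2 place, 4 split `ncoef (v k zzcoef)* zzub len`, 5 fit `zzqw zzqx zzqy zzqz refl ncerts cert*`),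
and the kernel-decided sanity checks of the brace / bond pair tables and of the certificate count `954` for `ptab26`.
Only the census DATA files and the `native_decide` check files import this part; the soundness chain
(`…Sound1` … `…Fit`, `…Rat`) does not.  `[folklore]`; no `sorry`; no `instance`/`notation`; no data.
-/

namespace Summit.AtomisticToContinuum.Crystallization.Theorems

namespace Rig

open Literature.Analysis.ValidatedNumerics.NumericsMP

/-! ### Decoding (same byte format as `…RigModels.decodeCell`; opcodes 4 = split, 5 = fit) -/

/-- Read `n` sparse coefficient entries `(v, k, zigzag coefficient)`. -/
def readCoeffs : ℕ → Cur → List (ℕ × ℕ × ℤ) × Cur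
  | 0, c => ([], c)
  | n + 1, c =>
    let (v, c) := c.next
    let (k, c) := c.next
    let (z, c) := c.next
    let (ts, c) := readCoeffs n c
    ((v, k, unzz z) :: ts, c)

/-- Read the fit instruction stream (fuel-bounded): `0 v k up cert` · `1 terms` · `2 terms altLen` ·
`4 ncoef (v k zzcoef)* zzub len` · `5 zzqw zzqx zzqy zzqz refl ncerts cert*`. -/
def readInstrsF : ℕ → Cur → List InstrF
  | 0, _ => []
  | fuel + 1, c =>
    if c.done then []
    else
      let (op, c) := c.next
      if op = 0 then
        let (v, c) := c.next
        let (k, c) := c.next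
        let (up, c) := c.next
        let (ct, c) := readCert c
        InstrF.bound (toFin12 v) (toFin3 k) (up = 1) ct :: readInstrsF fuel c
      else if op = 1 then
        let (ts, c) := readTermList c
        InstrF.prune ts :: readInstrsF fuel c
      else if op = 2 then
        let (ts, c) := readTermList c
        let (n, c) := c.next
        InstrF.place ts n :: readInstrsF fuel c
      else if op = 4 then
        let (na, c) := c.next
        let (a, c) := readCoeffs na c
        let (ub, c) := c.next
        let (n, c) := c.next
        InstrF.split a (unzz ub) n :: readInstrsF fuel c
      else if op = 5 then
        let (qw, c) := c.next
        let (qx, c) := c.next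
        let (qy, c) := c.next
        let (qz, c) := c.next
        let (rf, c) := c.next
        let (nc, c) := c.next
        let (cts, c) := readCerts nc c
        InstrF.fit (unzz qw) (unzz qx) (unzz qy) (unzz qz) (rf = 1) cts :: readInstrsF fuel c
      else []

/-- **Decode a fit cell** from its base64 text (`xpos tlo thi` header as in `decodeCell`). -/
def decodeCellF (s : String) : CellF :=
  let d := varints (decodeB64 s)
  let c : Cur := ⟨d, 0⟩
  let (xp, c) := c.next
  let (tlo, c) := c.next
  let (thi, c) := c.next
  { xpos := (xp = 1), tlo := unzz tlo, thi := unzz thi, instrs := readInstrsF d.size c }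

/-! ### Sanity checks of the tables (kernel-decided) -/

/-- fcc has twelve `√2`-pairs (the face diagonals of the six square faces of the cuboctahedron). -/
example : (bracePairs fccModel).length = 12 := by decide

/-- hcp has twelve `√2`-pairs as well (the diagonals of the six square faces of the anticuboctahedron). -/
example : (bracePairs hcpModel).length = 12 := by decide

/-- Both models have 24 bonded pairs `i < j`. -/
example : (bondPairs fccModel).length = 24 ∧ (bondPairs hcpModel).length = 24 := by decide

/-- A fit over `ptab26` consumes `18 + 12·26 + 24·26 = 954` certificates. -/
example : 18 + 12 * ptab26.length + 24 * ptab26.length = 954 := by decide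

end Rig

end Summit.AtomisticToContinuum.Crystallization.Theorems
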